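import Literature.AnabelianGeometry.EtaleTheta.FrobenioidMonoThetaEnv
import Literature.AnabelianGeometry.EtaleTheta.Discharge.Sec5MonoThetaUniversalClosureRefuted
import Mathlib.Algebra.Group.TypeTags.Finite
import Mathlib.GroupTheory.SpecificGroups.Cyclic

/-!
# [EtTh] Lemma 5.9 (iv) and its "In particular": the universal closures over the DATA-ONLY §5 interface are
# FALSE (kernel countermodels; FACT-LIST rows F-0545 `EnvIsoBiTheta`, F-0546 `FrdIsMonoThetaEnv` — R5)

Mochizuki, *The étale theta function and its Frobenioid-theoretic manifestations*, Publ. RIMS **45** (2009),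
Lemma 5.9 (iv) (p.332 (PDF p.106)) [cite: MochizukiEtTh2009, Lem 5.9 (iv) p.332 (PDF p.106)].  Cell abc-iut, block F
(fact-proving wave), seat abc-iut-f-112 (FLOAT onto the unseated tranche 123); PROOF-ONLY companion of
abc-iut-L2-t4's `FrobenioidMonoThetaEnv.lean`.  No new `Prop` fact, no edit of a statement file; the only
definitions are toy data.

WHAT IS PROVED.  `EnvIsoBiTheta` ("`E^Π_N ⥲ Π^tp_Y[μ_N]` is an isomorphism of mod `N` bi-theta environments with
the model one") and `FrdIsMonoThetaEnv` ("omitting `s^⊓-Π_N` yields a mod `N` mono-theta environment") are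
PREDICATES on the §5 data `𝔉 : ThetaFrobenioid C D`, on the named §5 facts `h1 hsec hcs h8` they presuppose, on
the Kummer parameter `DK`, and on abc-iut-L2-t2's PARAMETER `T : ThetaEnvData N` (+ `ι : Π^tp_X ≃ T.Π^tp_X`) —
a 25-field DATA interface.  Their universal closures are refuted by a third toy datum:
* `toyTheta4 := {Cor512Toy.toyTheta with N := 4, Π^tp_X := ℤ × (ℤ/2 × ℤ/2), Π^tp_Ÿ := the kernel of the MIDDLE
  factor inside Π^tp_Y = Ker(pr₁), ρ := 1, s^⊔-gp_N := 1}` over `C = Fin 2 × SingleObj ℤ/2`, `D = Discrete PUnit`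
  — here `Aut_D(B_N^bs) = 1`, so `SgpCapSection`, `SgpCupSection`, `SectionsFactor`, `ConstantsEqNormalizer` all
  HOLD (`sgpCapSection4`, …), and `E^Π_N = E_N × Π^tp_Y` has `|E_N| = |μ_4(O^×(B_N))| = |ℤ/2| = 2`, hence
  `|E^Π_N| = 8`;
* `toyT : ThetaEnvData 4` on the SAME `Π^tp_X`, with `G_K := 1`, `μ_4 := ℤ/4`, trivial character, θ-cocycles
  `{1}`, `Π^tp_Y := Ker(pr₁)` (forced) but `Π^tp_Ÿ :=` the kernel of the LAST factor — so `|Π^tp_Y[μ_4]| = 16`.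
Then with `ι := id`: F-0545 fails at its clause "`ι(Π^tp_Ÿ) = T.Π^tp_Ÿ`" (`not_envIsoBiTheta_toy`), and F-0546
fails because an isomorphism of mono-theta environments would be a bijection `E^Π_N ≃ Π^tp_Y[μ_4]`, `8 ≠ 16`
(`not_frdIsMonoThetaEnv_toy`); the `¬ ∀` forms quantify over the decls' own binders at universe `0`.
WHAT THIS MEANS (R5).  Both rows are hypotheses relating the NAMED §5 Frobenioid of `Ÿ` to the NAMED model
theta environment of [EtTh] §2 for the same curve (the intended `T`, `ι`: `TODO-merge(abc-iut-L2-t2)` in the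
statement file); over arbitrary `(𝔉, T, ι)` they are not theorems.  Instance form in tree:
`frdIsMonoThetaEnv_of : EnvIsoBiTheta → FrdIsMonoThetaEnv` (L2-t4, PROVED).  HONEST FRAMING: toy data say
nothing about the §5 Frobenioid or [IUTchIII] Cor. 3.12; refuted-as-schema ≠ refuted-in-print; no side taken.
-/

namespace Literature.AnabelianGeometry.EtaleTheta

namespace ThetaFrobenioid

namespace Lem59ivToy

open CategoryTheory
open Literature.AlgebraicGeometry.Frobenioids
open ConstantMultiple.Cor512Toy
open MonoThetaToy (PiX' piMid map_piMid_ker_fst)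

/-! ### Bookkeeping on `ℤ/2`, `Aut_C(Q)` and `Ker(pr₁) ⊆ ℤ × (ℤ/2)²` -/

/-- `m² = 1` in `ℤ/2`. [cite: MochizukiEtTh2009, §5 p.331 (PDF p.105)] -/
theorem Mm_mul_self : ∀ m : Mm, m * m = 1 := by decide

/-- `m⁴ = 1` in `ℤ/2`. [cite: MochizukiEtTh2009, §5 p.331 (PDF p.105)] -/
theorem Mm_pow_four : ∀ m : Mm, m ^ 4 = 1 := by decide

/-- `|ℤ/2| = 2`. [cite: MochizukiEtTh2009, §5 p.331 (PDF p.105)] -/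
theorem card_Mm : Nat.card Mm = 2 := by
  rw [Nat.card_congr Multiplicative.toAdd, Nat.card_zmod]

/-- `Aut_C(Q) ≃ ℤ/2` (the `SingleObj` coordinate). [cite: MochizukiEtTh2009, §5 p.331 (PDF p.105)] -/
def autQEquiv : Aut Q ≃ Mm where
  toFun a := a.hom.2
  invFun m := ⟨(𝟙 _, m), (𝟙 _, (m⁻¹ : Mm)), Prod.ext (Subsingleton.elim _ _) (inv_mul_cancel m),
    Prod.ext (Subsingleton.elim _ _) (mul_inv_cancel m)⟩
  left_inv _ := Aut.ext (Prod.ext (Subsingleton.elim _ _) rfl)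
  right_inv _ := rfl

/-- `|Aut_C(Q)| = 2`. [cite: MochizukiEtTh2009, §5 p.331 (PDF p.105)] -/
theorem card_autQ : Nat.card (Aut Q) = 2 := by
  rw [Nat.card_congr autQEquiv, card_Mm]

/-- Every automorphism of `Q` squares to the identity. [cite: MochizukiEtTh2009, §5 p.331 (PDF p.105)] -/
theorem autQ_mul_self (a : Aut Q) : a * a = 1 :=
  Aut.ext (Prod.ext (Subsingleton.elim _ _) (Mm_mul_self a.hom.2))

/-- `a⁴ = 1` in `Aut_C(Q)`. [cite: MochizukiEtTh2009, §5 p.331 (PDF p.105)] -/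
theorem autQ_pow_four (a : Aut Q) : a ^ 4 = 1 := by
  rw [show (4 : ℕ) = 2 * 2 from rfl, pow_mul, pow_two, autQ_mul_self]

/-- `Ker(pr₁ : ℤ × (ℤ/2)² → ℤ) ≃ (ℤ/2)²`. [cite: MochizukiEtTh2009, §5 p.332 (PDF p.106)] -/
def kerFstEquiv' : (MonoidHom.fst (Multiplicative ℤ) (Mm × Mm)).ker ≃ Mm × Mm where
  toFun x := x.1.2
  invFun p := ⟨(1, p), (MonoidHom.mem_ker).mpr rfl⟩
  left_inv x := by
    obtain ⟨⟨a, p⟩, h⟩ := x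
    have h' : a = 1 := (MonoidHom.mem_ker).mp h
    subst h'
    rfl
  right_inv _ := rfl

/-- `|Ker(pr₁)| = 4`. [cite: MochizukiEtTh2009, §5 p.332 (PDF p.106)] -/
theorem card_kerFst : Nat.card (MonoidHom.fst (Multiplicative ℤ) (Mm × Mm)).ker = 4 := by
  rw [Nat.card_congr kerFstEquiv', Nat.card_prod, card_Mm]

/-- The last factor `Π^tp_X → ℤ/2`. [cite: MochizukiEtTh2009, §5 p.332 (PDF p.106)] -/
def piLast : PiX' →* Mm := (MonoidHom.snd Mm Mm).comp (MonoidHom.snd (Multiplicative ℤ) (Mm × Mm))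

/-- `Ker(pr₁)` maps ONTO `ℤ/2` under the last factor. [cite: MochizukiEtTh2009, §5 p.332 (PDF p.106)] -/
theorem map_piLast_ker_fst :
    ((MonoidHom.fst (Multiplicative ℤ) (Mm × Mm)).ker).map piLast = ⊤ := by
  refine top_le_iff.mp fun m _ => ?_
  exact ⟨(1, (1, m)), (MonoidHom.mem_ker).mpr rfl, rfl⟩

/-! ### The third toy §5 datum -/

/-- **The third toy §5 datum** `toyTheta4`: abc-iut-f-112's `Cor512Toy.toyTheta` with `N := 4`,
`Π^tp_X := ℤ × (ℤ/2 × ℤ/2)`, `Π^tp_Ÿ := Ker(middle factor) ∩ Ker(pr₁)`, `ρ := 1`, `s^⊔-gp_N := 1` (base category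
`Discrete PUnit`, so `Aut_D(B_N^bs) = 1`).  [cite: MochizukiEtTh2009, §5 pp.330–332 (PDF pp.104–106)] -/
def toyTheta4 : ThetaFrobenioid.{0} TC TD :=
  { toyTheta with
    N := 4
    PiX := PiX'
    instGroupPiX := inferInstance
    instTopPiX := inferInstance
    instTopGroupPiX := inferInstance
    zquot := MonoidHom.fst _ _
    zquot_surjective := fun z => ⟨(z, 1), rfl⟩
    PiYdd := piMid.ker ⊓ (MonoidHom.fst (Multiplicative ℤ) (Mm × Mm)).ker
    PiYdd_le := inf_le_right
    relindex_PiYdd := by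
      rw [Subgroup.inf_relIndex_right, Subgroup.relIndex_ker, map_piMid_ker_fst, Subgroup.card_top, card_Mm]
    PiYdd_normal := inferInstance
    isOpen_PiYdd := isOpen_discrete _
    ρ := 1
    ρ_surjective := fun _ => ⟨1, Aut.ext (Subsingleton.elim _ _)⟩
    isOpen_ker_ρ := isOpen_discrete _
    sgpCup := 1 }

/-- `Aut_C(B_N) → Aut_D(B_N^bs)` is trivial (the base automorphism group is trivial).
[cite: MochizukiEtTh2009, §5 p.331 (PDF p.105)] -/
theorem autBase4 (a : Aut Q) : toyTheta4.autBase toyTheta4.BN a = 1 := Aut.ext (Subsingleton.elim _ _)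

/-- `SgpCapSection` HOLDS at `toyTheta4`. [cite: MochizukiEtTh2009, §5 p.331 (PDF p.105)] -/
theorem sgpCapSection4 : toyTheta4.SgpCapSection := fun _ => Aut.ext (Subsingleton.elim _ _)

/-- `SgpCupSection` HOLDS at `toyTheta4`. [cite: MochizukiEtTh2009, §5 p.331 (PDF p.105)] -/
theorem sgpCupSection4 : toyTheta4.SgpCupSection := fun _ => Aut.ext (Subsingleton.elim _ _)

/-- `SectionsFactor` (Lemma 5.9 (i)) HOLDS at `toyTheta4` (both sections are trivial).
[cite: MochizukiEtTh2009, Lem 5.9 (i) p.331 (PDF p.105)] -/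
theorem sectionsFactor4 : toyTheta4.SectionsFactor :=
  ⟨fun _ => toyTheta4.EN.one_mem, fun _ => toyTheta4.EN.one_mem⟩

/-- Every automorphism of `B_N = Q` is a unit at `toyTheta4`. [cite: MochizukiEtTh2009, §5 p.331 (PDF p.105)] -/
theorem mem_units4 (a : Aut Q) : a ∈ toyTheta4.units toyTheta4.BN := ⟨rfl, degFr_QQ a.hom⟩

/-- Every unit lies in `(O_K^×)^{1/N}` at `toyTheta4` (its image in `ℤ/2` has fourth power `1`, a constant).
[cite: MochizukiEtTh2009, Lem 5.8 p.331 (PDF p.105)] -/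
theorem mem_OKxRootN4 (a : Aut Q) : a ∈ toyTheta4.OKxRootN := by
  refine Subgroup.mem_map.mpr ⟨⟨a, mem_units4 a⟩, ?_, rfl⟩
  rw [Subgroup.mem_comap, ThetaFrobenioid.mem_KxRootN]
  exact ⟨1, ((Mm_pow_four (autToM Q a)).symm : (1 : Mm) = autToM Q a ^ 4)⟩

/-- Every automorphism of `Q` normalizes `E_N` at `toyTheta4` (`Aut_C(Q)` is abelian).
[cite: MochizukiEtTh2009, Lem 5.8 p.331 (PDF p.105)] -/
theorem mem_normalizer_EN4 (g : Aut toyTheta4.BN) :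
    g ∈ Subgroup.normalizer (toyTheta4.EN : Set (Aut toyTheta4.BN)) := by
  rw [Subgroup.mem_normalizer_iff]
  intro h
  rw [show g * h = h * g from aut_mul_comm Q g h, mul_assoc, mul_inv_cancel, mul_one]

/-- `ConstantsEqNormalizer` (Lemma 5.8) HOLDS at `toyTheta4`: both sides are all of `Aut_C(B_N)`.
[cite: MochizukiEtTh2009, Lem 5.8 p.331 (PDF p.105)] -/
theorem constantsEqNormalizer4 : toyTheta4.ConstantsEqNormalizer := by
  ext u
  rw [Subgroup.mem_inf]
  exact ⟨fun _ => ⟨mem_units4 u, mem_normalizer_EN4 u⟩, fun _ => mem_OKxRootN4 u⟩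

/-- Every automorphism of `Q` lies in `E_N` at `toyTheta4` (`μ_4(O^×(B_N)) = O^×(B_N) = Aut_C(Q)`).
[cite: MochizukiEtTh2009, §5 p.331 (PDF p.105)] -/
theorem mem_EN4 (a : Aut Q) : a ∈ toyTheta4.EN :=
  Subgroup.mem_sup_right ⟨mem_units4 a, autQ_pow_four a⟩

/-- `E^Π_N ≃ Aut_C(Q) × Ker(pr₁)` at `toyTheta4`. [cite: MochizukiEtTh2009, Lem 5.9 (iv) p.332 (PDF p.106)] -/
def epinEquiv : toyTheta4.EPiN ≃ Aut Q × (MonoidHom.fst (Multiplicative ℤ) (Mm × Mm)).ker where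
  toFun x := (x.1.1, ⟨x.1.2, x.2.2.1⟩)
  invFun p := ⟨(p.1, p.2.1), ⟨mem_EN4 p.1, p.2.2, Aut.ext (Subsingleton.elim _ _)⟩⟩
  left_inv _ := rfl
  right_inv _ := rfl

/-- `|E^Π_N| = 8` at `toyTheta4`. [cite: MochizukiEtTh2009, Lem 5.9 (iv) p.332 (PDF p.106)] -/
theorem card_EPiN4 : Nat.card toyTheta4.EPiN = 8 := by
  rw [Nat.card_congr epinEquiv, Nat.card_prod, card_autQ, card_kerFst]

/-! ### A toy `ThetaEnvData 4` on the same `Π^tp_X` -/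

/-- **A toy inhabitant of abc-iut-L2-t2's `ThetaEnvData 4`** on `Π^tp_X := ℤ × (ℤ/2)²`: `G_K := 1`, `Π^tp_Y :=
Ker(pr₁)`, `Π^tp_Ÿ := Ker(last factor) ∩ Ker(pr₁)`, `μ_4 := ℤ/4` with trivial character, θ-cocycles `{1}`.
[cite: MochizukiEtTh2009, Def 2.13 p.47] -/
noncomputable def toyT : ThetaEnvData.{0} 4 where
  PiX := PiX'
  G := PUnit
  aug := 1
  aug_surjective := fun _ => ⟨1, Subsingleton.elim _ _⟩
  PiY := (MonoidHom.fst (Multiplicative ℤ) (Mm × Mm)).ker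
  PiY_normal := inferInstance
  PiY_open := isOpen_discrete _
  galYX := QuotientGroup.quotientKerEquivOfSurjective (MonoidHom.fst (Multiplicative ℤ) (Mm × Mm))
    (fun z => ⟨(z, 1), rfl⟩)
  PiYdd := piLast.ker ⊓ (MonoidHom.fst (Multiplicative ℤ) (Mm × Mm)).ker
  PiYdd_le := inf_le_right
  PiYdd_normal := inferInstance
  PiYdd_open := isOpen_discrete _
  index_PiYdd := by
    change (piLast.ker ⊓ (MonoidHom.fst (Multiplicative ℤ) (Mm × Mm)).ker).relIndex _ = 2
    rw [Subgroup.inf_relIndex_right, Subgroup.relIndex_ker, map_piLast_ker_fst, Subgroup.card_top, card_Mm]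
  mu := Multiplicative (ZMod 4)
  mu_cyclic := inferInstance
  card_mu := by decide
  chi := 1
  chi_ker_open := isOpen_discrete _
  thetaCocycles := {1}
  thetaCocycles_nonempty := ⟨1, rfl⟩
  isCocycle := by
    rintro η rfl g h
    simp
  locallyConstant := by
    rintro η rfl
    exact IsLocallyConstant.const 1
  mul_coboundary_mem := by
    rintro η rfl c
    rw [Set.mem_singleton_iff, one_mul]
    funext g
    simp [CycEnvelope.coboundary]

/-- `|Π^tp_Y[μ_4]| = 16` for the toy theta environment. [cite: MochizukiEtTh2009, Def 2.13 p.47] -/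
theorem card_env : Nat.card toyT.env = 16 := by
  have e : toyT.env ≃ Multiplicative (ZMod 4) × (MonoidHom.fst (Multiplicative ℤ) (Mm × Mm)).ker :=
    ⟨fun x => (x.left, x.right), fun p => ⟨p.1, p.2⟩, fun _ => rfl, fun _ => rfl⟩
  rw [Nat.card_congr e, Nat.card_prod, Nat.card_congr Multiplicative.toAdd, Nat.card_zmod, card_kerFst]

/-! ### F-0545 `EnvIsoBiTheta` (Lemma 5.9 (iv)) -/

/-- Lemma 5.9 (iv) FAILS at `(toyTheta4, toyT, ι = id)`: `ι(Π^tp_Ÿ)` is the middle-factor kernel, `T.Π^tp_Ÿ` the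
last-factor kernel.  [cite: MochizukiEtTh2009, Lem 5.9 (iv) p.332 (PDF p.106)] -/
theorem not_envIsoBiTheta_toy :
    ¬ toyTheta4.EnvIsoBiTheta sectionsFactor4 toyTheta4.outerActionLZ_of sgpCapSection4 sgpCupSection4
        constantsEqNormalizer4 ∅ toyT (ContinuousMulEquiv.refl _) := by
  rintro ⟨-, h2, -⟩
  have hm : ((1 : Multiplicative ℤ), ((1 : Mm), m0)) ∈ toyT.PiYdd := by
    rw [← h2]
    exact ⟨(1, (1, m0)), ⟨(MonoidHom.mem_ker).mpr rfl, (MonoidHom.mem_ker).mpr rfl⟩, rfl⟩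
  have h3 : m0 = 1 := (MonoidHom.mem_ker).mp hm.1
  exact absurd h3 (by decide)

/-- **F-0545: the universal closure of `ThetaFrobenioid.EnvIsoBiTheta` is FALSE** (R5: a hypothesis relating the
NAMED §5 Frobenioid to the NAMED model theta environment of the same curve; the parameters `T`, `ι` are free data
in the interface).  [cite: MochizukiEtTh2009, Lem 5.9 (iv) p.332 (PDF p.106)] -/
theorem not_forall_envIsoBiTheta :
    ¬ ∀ (C : Type) [Category.{0} C] (D : Type) [Category.{0} D] (𝔉 : ThetaFrobenioid.{0} C D)
        (h1 : 𝔉.SectionsFactor) (h3 : 𝔉.OuterActionLZ) (hsec : 𝔉.SgpCapSection) (hcs : 𝔉.SgpCupSection)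
        (h8 : 𝔉.ConstantsEqNormalizer) (DK : Set (TopOut 𝔉.EPiN)) (T : ThetaEnvData.{0} 𝔉.N)
        (ι : 𝔉.PiX ≃ₜ* T.PiX), 𝔉.EnvIsoBiTheta h1 h3 hsec hcs h8 DK T ι :=
  fun h => not_envIsoBiTheta_toy (h _ _ toyTheta4 _ _ _ _ _ _ toyT _)

/-! ### F-0546 `FrdIsMonoThetaEnv` (Lemma 5.9 (iv), "In particular") -/

/-- "omitting `s^⊓-Π_N` yields a mod `N` mono-theta environment" FAILS at `(toyTheta4, toyT)`: an isomorphism with a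
model environment would be a bijection `E^Π_N ≃ Π^tp_Y[μ_4]`, but `|E^Π_N| = 8 ≠ 16`.
[cite: MochizukiEtTh2009, Lem 5.9 (iv) p.332 (PDF p.106)] -/
theorem not_frdIsMonoThetaEnv_toy :
    ¬ toyTheta4.FrdIsMonoThetaEnv sectionsFactor4 toyTheta4.outerActionLZ_of sgpCapSection4 sgpCupSection4
        constantsEqNormalizer4 ∅ toyT := by
  rintro ⟨η, hη, ⟨i⟩⟩
  have hc := Nat.card_congr i.e.toMulEquiv.toEquiv
  have hc' : (8 : ℕ) = 16 := by rw [← card_EPiN4, ← card_env]; exact hc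
  exact absurd hc' (by decide)

/-- **F-0546: the universal closure of `ThetaFrobenioid.FrdIsMonoThetaEnv` is FALSE** (R5; instance form in tree:
`frdIsMonoThetaEnv_of` ⇐ `EnvIsoBiTheta`, L2-t4 PROVED).  [cite: MochizukiEtTh2009, Lem 5.9 (iv) p.332 (PDF p.106)] -/
theorem not_forall_frdIsMonoThetaEnv :
    ¬ ∀ (C : Type) [Category.{0} C] (D : Type) [Category.{0} D] (𝔉 : ThetaFrobenioid.{0} C D)
        (h1 : 𝔉.SectionsFactor) (h3 : 𝔉.OuterActionLZ) (hsec : 𝔉.SgpCapSection) (hcs : 𝔉.SgpCupSection)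
        (h8 : 𝔉.ConstantsEqNormalizer) (DK : Set (TopOut 𝔉.EPiN)) (T : ThetaEnvData.{0} 𝔉.N),
        𝔉.FrdIsMonoThetaEnv h1 h3 hsec hcs h8 DK T :=
  fun h => not_frdIsMonoThetaEnv_toy (h _ _ toyTheta4 _ _ _ _ _ _ toyT)

end Lem59ivToy

end ThetaFrobenioid

end Literature.AnabelianGeometry.EtaleTheta
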